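import Summits.AnomalousDissipation.AnomalousDissipation.Theorems.SolenoidalFractalHomogenisationLagrangianStepW7DrainFloor
import Literature.Analysis.FluidPDE.PassiveVectorTensorTwistedModalSymbol
import HarnessLib

/-!
# K1L_D (stmt-AnomalousDissipation-27980), (ℓ3) (D-TH)₀ «frozen-frame W7» — THE DRAIN-FLOOR GEOMETRY AT REAL WAVE VECTORS
# (helper; `--supports stmt-AnomalousDissipation-27980 --as helper`)

Port of `…W7DrainFloor` (this lineage g11) under `transversalProj K ↦ transversalProjR q`, `kdot K ↦ rdot q`, `freqNormSq K ↦ Σ_a q_a²` for REAL wave vectors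
`q : Fin 3 → ℝ` (frozen-frame chains `q₀ = G₀ᵀK₀`, neighbours `q₀ ± q_s`, `q_s = G₀ᵀ(n·m_s)`; prover ad-sawtooth-k1loc-p1 g16, memo
`HOME/ad-sawtooth-k1loc-p1/g16/DTH-costline-k1locp1g16.md` §2, RULING D28-19 (2)).  The drain floor is the hypothesis `hqw` of `W7Slot.slot_stepR` (p725843):
* §1 `rdot_add_left` / `rdot_sub_left`, **`norm_rdot_sq_le_of_rdot_eq_zero`** — transversal Cauchy–Schwarz `|q_s·z|² ≤ (|q_s|² − (q₀·q_s)²/|q₀|²)‖z‖²` for `z ⊥ q₀`;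
* §2 **`drain_floor_pairR`** — `(2 − |q_s^⊥|²(1/|q₀+q_s|² + 1/|q₀−q_s|²))·‖z‖² ≤ ‖P_{q₀+q_s} z‖² + ‖P_{q₀−q_s} z‖²` (Pythagoras `norm_sq_transversalProjR` of
  `Literature/…/PassiveVectorTensorTwistedModalSymbol`);
* §3 `sumSq_add_three` / `sumSq_sub_three` / `dotR_sq_le_sumSq_mul`, `drain_floor_coeffR_le_two`, **`drain_floor_coeffR_lower`** —
  `2(q₀·q_s)²/(|q₀|²(|q_s| + |q₀|)²) ≤ coefficient` for `q₀ ≠ 0` (the scalar floor `W7Slot.scalar_floor`, pure real analysis, reused by name).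
No definitions, no sorry.  NOT a proof of any block, of `stub_W7thg`, of K1L_D or of AD; rung F-D1.A0.
[cite: BedrossianCotiZelati2017, §2 (hypocoercivity functional)] [problem: turb]
-/

set_option linter.dupNamespace false

namespace Summit.AnomalousDissipation.AnomalousDissipation.Theorems.SolenoidalFractalHomogenisation.LagrangianStep.W7Slot

open scoped InnerProductSpace
open Literature.Analysis.FluidPDE Literature.Analysis.FluidPDE.Torus

/-! ## §1 Transversal Cauchy–Schwarz at real wave vectors -/

/-- `rdot` is additive in the (real) wave vector. -/
theorem rdot_add_left (q q' : Fin 3 → ℝ) (z : EuclideanSpace ℂ (Fin 3)) : rdot (q + q') z = rdot q z + rdot q' z := by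
  simp only [rdot_apply, Pi.add_apply, Complex.ofReal_add, add_mul, Finset.sum_add_distrib]

/-- `rdot` is subtractive in the (real) wave vector. -/
theorem rdot_sub_left (q q' : Fin 3 → ℝ) (z : EuclideanSpace ℂ (Fin 3)) : rdot (q - q') z = rdot q z - rdot q' z := by
  simp only [rdot_apply, Pi.sub_apply, Complex.ofReal_sub, sub_mul, Finset.sum_sub_distrib]

/-- **Transversal Cauchy–Schwarz, real wave vectors**: for `z ⊥ q₀` (`q₀·z = 0`), `|q_s·z|² ≤ (|q_s|² − (q₀·q_s)²/|q₀|²)·‖z‖²`. -/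
theorem norm_rdot_sq_le_of_rdot_eq_zero (q0 qs : Fin 3 → ℝ) {z : EuclideanSpace ℂ (Fin 3)} (hz : rdot q0 z = 0) :
    ‖rdot qs z‖ ^ 2 ≤ ((∑ a, qs a ^ 2) - (∑ i, q0 i * qs i) ^ 2 / ∑ a, q0 a ^ 2) * ‖z‖ ^ 2 := by
  set κ : ℝ := ∑ i, q0 i * qs i with hκ
  set F : ℝ := ∑ a, q0 a ^ 2 with hFdef
  -- the real vector `q_s − (κ/F) q₀`, seen in `ℂ³`
  set a : EuclideanSpace ℂ (Fin 3) := WithLp.toLp 2 fun i => (((qs i) - κ / F * (q0 i) : ℝ) : ℂ) with ha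
  have ha_apply : ∀ i, a i = (((qs i) - κ / F * (q0 i) : ℝ) : ℂ) := fun i => rfl
  have hinner : ⟪a, z⟫_ℂ = rdot qs z := by
    have h1 : ⟪a, z⟫_ℂ = ∑ i, (((qs i) - κ / F * (q0 i) : ℝ) : ℂ) * z i := by
      rw [PiLp.inner_apply]
      refine Finset.sum_congr rfl fun i _ => ?_
      rw [RCLike.inner_apply, ha_apply, Complex.conj_ofReal, mul_comm]
    have h2 : ∑ i, (((qs i) - κ / F * (q0 i) : ℝ) : ℂ) * z i = rdot qs z - ((κ / F : ℝ) : ℂ) * rdot q0 z := by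
      rw [rdot_apply, rdot_apply, Finset.mul_sum, ← Finset.sum_sub_distrib]
      refine Finset.sum_congr rfl fun i _ => ?_
      push_cast; ring
    rw [h1, h2, hz, mul_zero, sub_zero]
  have hnorm_a : ‖a‖ ^ 2 = (∑ a, qs a ^ 2) - κ ^ 2 / F := by
    rw [EuclideanSpace.norm_sq_eq]
    have h1 : ∑ i, ‖a i‖ ^ 2 = ∑ i, ((qs i) - κ / F * (q0 i)) ^ 2 := by
      refine Finset.sum_congr rfl fun i _ => ?_
      rw [ha_apply, Complex.norm_real, Real.norm_eq_abs, sq_abs]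
    rw [h1]
    have h2 : ∑ i, ((qs i) - κ / F * (q0 i)) ^ 2 = (∑ a, qs a ^ 2) - 2 * (κ / F) * κ + (κ / F) ^ 2 * F := by
      have eκ : κ = q0 0 * qs 0 + q0 1 * qs 1 + q0 2 * qs 2 := by rw [hκ, Fin.sum_univ_three]
      have eF : F = q0 0 ^ 2 + q0 1 ^ 2 + q0 2 ^ 2 := by rw [hFdef, Fin.sum_univ_three]
      have eM : ∑ a, qs a ^ 2 = qs 0 ^ 2 + qs 1 ^ 2 + qs 2 ^ 2 := by rw [Fin.sum_univ_three]
      rw [Fin.sum_univ_three, eM]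
      set c : ℝ := κ / F
      rw [eκ, eF]
      ring
    rw [h2]
    by_cases hF0 : F = 0
    · rw [hF0]; simp
    · field_simp; ring
  have hcs : ‖rdot qs z‖ ≤ ‖a‖ * ‖z‖ := by rw [← hinner]; exact norm_inner_le_norm a z
  have h0 : 0 ≤ ‖rdot qs z‖ := norm_nonneg _
  calc ‖rdot qs z‖ ^ 2 ≤ (‖a‖ * ‖z‖) ^ 2 := pow_le_pow_left₀ h0 hcs 2
    _ = ((∑ a, qs a ^ 2) - κ ^ 2 / F) * ‖z‖ ^ 2 := by rw [mul_pow, hnorm_a]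

/-! ## §2 The drain floor, pair form -/

/-- **Drain-floor geometry (pair form, real wave vectors).**  For `z ⊥ q₀` and the chain neighbours `q₀ ± q_s`:
`(2 − |q_s^⊥|²(1/|q₀+q_s|² + 1/|q₀−q_s|²))·‖z‖² ≤ ‖P_{q₀+q_s} z‖² + ‖P_{q₀−q_s} z‖²`, `|q_s^⊥|² = |q_s|² − (q₀·q_s)²/|q₀|²`.
This is the hypothesis `hqw` of `W7Slot.slot_stepR`. [cite: BedrossianCotiZelati2017, §2 (hypocoercivity functional)] -/
theorem drain_floor_pairR (q0 qs : Fin 3 → ℝ) {z : EuclideanSpace ℂ (Fin 3)} (hz : rdot q0 z = 0) :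
    (2 - ((∑ a, qs a ^ 2) - (∑ i, q0 i * qs i) ^ 2 / ∑ a, q0 a ^ 2)
        * (1 / (∑ a, (q0 + qs) a ^ 2) + 1 / (∑ a, (q0 - qs) a ^ 2))) * ‖z‖ ^ 2
      ≤ ‖transversalProjR (q0 + qs) z‖ ^ 2 + ‖transversalProjR (q0 - qs) z‖ ^ 2 := by
  set M : ℝ := (∑ a, qs a ^ 2) - (∑ i, q0 i * qs i) ^ 2 / ∑ a, q0 a ^ 2 with hM
  have hp : rdot (q0 + qs) z = rdot qs z := by rw [rdot_add_left, hz, zero_add]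
  have hm : rdot (q0 - qs) z = -rdot qs z := by rw [rdot_sub_left, hz, zero_sub]
  rw [norm_sq_transversalProjR, norm_sq_transversalProjR, hp, hm, norm_neg]
  have hb := norm_rdot_sq_le_of_rdot_eq_zero q0 qs hz
  rw [← hM] at hb
  have hPp : 0 ≤ ∑ a, (q0 + qs) a ^ 2 := Finset.sum_nonneg fun a _ => sq_nonneg _
  have hPm : 0 ≤ ∑ a, (q0 - qs) a ^ 2 := Finset.sum_nonneg fun a _ => sq_nonneg _
  have h1 : ‖rdot qs z‖ ^ 2 / (∑ a, (q0 + qs) a ^ 2) ≤ M * ‖z‖ ^ 2 / (∑ a, (q0 + qs) a ^ 2) := div_le_div_of_nonneg_right hb hPp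
  have h2 : ‖rdot qs z‖ ^ 2 / (∑ a, (q0 - qs) a ^ 2) ≤ M * ‖z‖ ^ 2 / (∑ a, (q0 - qs) a ^ 2) := div_le_div_of_nonneg_right hb hPm
  have hexp : (2 - M * (1 / (∑ a, (q0 + qs) a ^ 2) + 1 / (∑ a, (q0 - qs) a ^ 2))) * ‖z‖ ^ 2
      = ‖z‖ ^ 2 - M * ‖z‖ ^ 2 / (∑ a, (q0 + qs) a ^ 2) + (‖z‖ ^ 2 - M * ‖z‖ ^ 2 / (∑ a, (q0 - qs) a ^ 2)) := by ring
  rw [hexp]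
  linarith

/-! ## §3 Bounds of the drain coefficient -/

/-- `|q + q'|² = |q|² + 2 q·q' + |q'|²` on `ℝ³`. -/
theorem sumSq_add_three (q q' : Fin 3 → ℝ) :
    ∑ a, (q + q') a ^ 2 = (∑ a, q a ^ 2) + 2 * (∑ i, q i * q' i) + ∑ a, q' a ^ 2 := by
  simp only [Fin.sum_univ_three, Pi.add_apply]; ring

/-- `|q − q'|² = |q|² − 2 q·q' + |q'|²` on `ℝ³`. -/
theorem sumSq_sub_three (q q' : Fin 3 → ℝ) :
    ∑ a, (q - q') a ^ 2 = (∑ a, q a ^ 2) - 2 * (∑ i, q i * q' i) + ∑ a, q' a ^ 2 := by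
  simp only [Fin.sum_univ_three, Pi.sub_apply]; ring

/-- Cauchy–Schwarz on `ℝ³`: `(q·q')² ≤ |q|²|q'|²`. -/
theorem dotR_sq_le_sumSq_mul (q q' : Fin 3 → ℝ) : (∑ i, q i * q' i) ^ 2 ≤ (∑ a, q a ^ 2) * ∑ a, q' a ^ 2 :=
  Finset.sum_mul_sq_le_sq_mul_sq Finset.univ q q'

/-- The coefficient of `drain_floor_pairR` is at most `2`. -/
theorem drain_floor_coeffR_le_two (q0 qs : Fin 3 → ℝ) :
    2 - ((∑ a, qs a ^ 2) - (∑ i, q0 i * qs i) ^ 2 / ∑ a, q0 a ^ 2)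
        * (1 / (∑ a, (q0 + qs) a ^ 2) + 1 / (∑ a, (q0 - qs) a ^ 2)) ≤ 2 := by
  have hF0 : 0 ≤ ∑ a, q0 a ^ 2 := Finset.sum_nonneg fun a _ => sq_nonneg _
  have hS0 : 0 ≤ ∑ a, qs a ^ 2 := Finset.sum_nonneg fun a _ => sq_nonneg _
  have hM : 0 ≤ (∑ a, qs a ^ 2) - (∑ i, q0 i * qs i) ^ 2 / ∑ a, q0 a ^ 2 := by
    by_cases hF : ∑ a, q0 a ^ 2 = 0
    · rw [hF, div_zero, sub_zero]; exact hS0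
    have hFp : 0 < ∑ a, q0 a ^ 2 := lt_of_le_of_ne hF0 (Ne.symm hF)
    rw [sub_nonneg, div_le_iff₀ hFp]
    have := dotR_sq_le_sumSq_mul q0 qs
    linarith [mul_comm (∑ a, q0 a ^ 2) (∑ a, qs a ^ 2)]
  have hS : 0 ≤ 1 / (∑ a, (q0 + qs) a ^ 2) + 1 / (∑ a, (q0 - qs) a ^ 2) := by
    have := Finset.sum_nonneg fun a (_ : a ∈ Finset.univ) => sq_nonneg ((q0 + qs) a)
    have := Finset.sum_nonneg fun a (_ : a ∈ Finset.univ) => sq_nonneg ((q0 - qs) a)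
    positivity
  linarith [mul_nonneg hM hS]

/-- **Scalar drain floor at real wave vectors**: `2(q₀·q_s)²/(|q₀|²(√|q_s|² + √|q₀|²)²) ≤ 2 − |q_s^⊥|²(1/|q₀+q_s|² + 1/|q₀−q_s|²)`
for `q₀ ≠ 0` (`W7Slot.scalar_floor` with `k = |q₀|`, `x = (q₀·q_s)/|q₀|`, `N = |q_s|`, `M = |q_s^⊥|²`). [cite: BedrossianCotiZelati2017, §2 (hypocoercivity functional)] -/
theorem drain_floor_coeffR_lower {q0 : Fin 3 → ℝ} (hq0 : q0 ≠ 0) (qs : Fin 3 → ℝ) :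
    2 * (∑ i, q0 i * qs i) ^ 2 / ((∑ a, q0 a ^ 2) * (Real.sqrt (∑ a, qs a ^ 2) + Real.sqrt (∑ a, q0 a ^ 2)) ^ 2)
      ≤ 2 - ((∑ a, qs a ^ 2) - (∑ i, q0 i * qs i) ^ 2 / ∑ a, q0 a ^ 2)
          * (1 / (∑ a, (q0 + qs) a ^ 2) + 1 / (∑ a, (q0 - qs) a ^ 2)) := by
  have hFp_eq := sumSq_add_three q0 qs
  have hFm_eq := sumSq_sub_three q0 qs
  have hcs := dotR_sq_le_sumSq_mul q0 qs
  have hFpos : 0 < ∑ a, q0 a ^ 2 := sum_sq_pos_of_ne_zero hq0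
  have hN2nn : 0 ≤ ∑ a, qs a ^ 2 := Finset.sum_nonneg fun a _ => sq_nonneg _
  set κ : ℝ := ∑ i, q0 i * qs i
  set F : ℝ := ∑ a, q0 a ^ 2
  set N2 : ℝ := ∑ a, qs a ^ 2
  have hk : 0 < Real.sqrt F := Real.sqrt_pos.2 hFpos
  have hk2 : Real.sqrt F ^ 2 = F := Real.sq_sqrt hFpos.le
  have hN2' : Real.sqrt N2 ^ 2 = N2 := Real.sq_sqrt hN2nn
  have hx2 : (κ / Real.sqrt F) ^ 2 = κ ^ 2 / F := by rw [div_pow, hk2]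
  have hkx : Real.sqrt F * (κ / Real.sqrt F) = κ := by field_simp
  have hMx : 0 ≤ N2 - κ ^ 2 / F := by
    rw [sub_nonneg, div_le_iff₀ hFpos]; linarith [mul_comm F N2]
  have h := scalar_floor (x := κ / Real.sqrt F) (M := N2 - κ ^ 2 / F) (Fp := ∑ a, (q0 + qs) a ^ 2)
    (Fm := ∑ a, (q0 - qs) a ^ 2) hk (Real.sqrt_nonneg N2) hMx (by rw [hx2, hN2']; ring)
    (by have e : (Real.sqrt F + κ / Real.sqrt F) ^ 2 = Real.sqrt F ^ 2 + 2 * (Real.sqrt F * (κ / Real.sqrt F))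
          + (κ / Real.sqrt F) ^ 2 := by ring
        rw [e, hkx, hx2, hk2, hFp_eq]; ring)
    (by have e : (Real.sqrt F - κ / Real.sqrt F) ^ 2 = Real.sqrt F ^ 2 - 2 * (Real.sqrt F * (κ / Real.sqrt F))
          + (κ / Real.sqrt F) ^ 2 := by ring
        rw [e, hkx, hx2, hk2, hFm_eq]; ring)
  have hlhs : 2 * κ ^ 2 / (F * (Real.sqrt N2 + Real.sqrt F) ^ 2)
      = 2 * (κ / Real.sqrt F) ^ 2 / (Real.sqrt N2 + Real.sqrt F) ^ 2 := by
    rw [hx2]; field_simp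
  rw [hlhs]
  exact h

end Summit.AnomalousDissipation.AnomalousDissipation.Theorems.SolenoidalFractalHomogenisation.LagrangianStep.W7Slot
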